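import Summits.HubbardSuperconductivity.HubbardSuperconductivity.Theorems.BalabanIRBirComplexStableXYRSectorCostLower
import Summits.HubbardSuperconductivity.HubbardSuperconductivity.Theorems.BalabanIRBirComplexStableXYRSectorStrainStructure
import HarnessLib

/-!
# Crux `BirComplexStableXYR` (stmt-HubbardSuperconductivity-14845), line `fat-gaussian-defect-calculus`, chapter 2
# §2.1: the holonomy sectors form a tilted three-dimensional theta series

Support file (prover seat 1, route BalabanIR; item G2 "Coulomb strain σ_a", holonomy part).

The pure holonomy sectors of lead c7's representation are the tree-gauge cochains `a = seam h`, `h ∈ ℤ³`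
(`TorusChart.seam`: the integer flux `h_μ` on the wrapping edges of direction `μ`; these are exactly the comb-vanishing
vortex-free cochains with winding vector `h`, `TorusChart.eq_of_comb_of_d₁_eq_of_wind_eq`).  For ANY strain map `σ`
with the two properties of `FSUnfolding.stub_fsRepresentation` this file proves:

* `hth_strain_seam_eq_sum` — `σ(seam h) = Σ_i h_i • σ(seam e_i)` (additivity `stub_strainAdditive`);
* **`stub_holonomyQuadraticForm`** (registered stub): there is a symmetric real `3 × 3` matrix `S` (the STIFFNESS or
  helicity matrix of the torus for the table `c`) with
  `𝒬(σ(seam h)) = Σ_{ij} S_{ij} h_i h_j` for all `h ∈ ℤ³`,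
  `8π²c₀|Λ|(h₀²/L² + h₁²/L² + h₂²/M²) ≤ hᵀSh ≤ |Λ|·Q(w ↦ 2π(h₀w₁/L + h₁w₂/L + h₂w₃/M))`
  (`stub_windingSectorCostLower`, B5 `FSUnfolding.stub_windingSectorCost`), and every real-linear functional of the
  strain is linear in `h`: `ℓ(σ(seam h)) = Σ_i h_i ℓ(σ(seam e_i))` — in particular the Berry phase
  `Φ(a) = K Σ_s m·P_s σ_a` of stub D1 is `K τ·h` on the holonomy sectors.

Consequently the vortex-free (`q = 0`) part of the sector series of `stub_fsRepresentation` has Gaussian weights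
`exp(−(K/2) hᵀSh + iK τ·h)`, a tilted theta series on the rank-3 lattice `(ℤ³, K·S)` — the format in which the line
card (§2.1, CAUTION) asks the `q = 0` positivity endgame to be run (Poisson dual = charge sectors).

No definitions; sorry-free. [folklore: Fröhlich–Spencer, CMP 81 (1981) §3; flux (toron) sectors of abelian lattice models]
-/

noncomputable section

namespace Summit.HubbardSuperconductivity.HubbardSuperconductivity.Theorems

set_option linter.dupNamespace false -- summit = problem name (single-conjunct summit), D-0017

open scoped BigOperators ComplexConjugate
open Complex Summit.HubbardSuperconductivity.BirComplexStableXYNegative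
open Literature.Probability.LatticeModels Literature.MathematicalPhysics.QuantumFieldTheory

section HolonomyTheta

variable {r : ℕ} {L M : ℕ} [NeZero L] [NeZero M]

/-- Seam cochains vanish on the comb (the comb has no wrapping edge). [folklore] -/
theorem hth_seam_comb (h : Fin 3 → ℤ) :
    ∀ (y : Λ L M) (μ : Fin 3), (∀ ν : Fin 3, μ < ν → (TorusChart.piProdZMod 2 L M).cval ν y = 0) →
      (TorusChart.piProdZMod 2 L M).cval μ y + 1 < (TorusChart.piProdZMod 2 L M).period μ →
      (TorusChart.piProdZMod 2 L M).seam h y μ = 0 :=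
  fun y μ _ hμ => (TorusChart.piProdZMod 2 L M).seam_of_lt h y μ hμ

/-- An integer vector is the integer combination of the unit vectors: `h = Σ_i h_i • e_i`. [folklore] -/
theorem hth_eq_sum_single (h : Fin 3 → ℤ) : h = ∑ i : Fin 3, h i • (Pi.single i (1 : ℤ) : Fin 3 → ℤ) := by
  funext j
  simp only [Finset.sum_apply, Pi.smul_apply, Pi.single_apply, smul_eq_mul, mul_ite, mul_one, mul_zero,
    Finset.sum_ite_eq, Finset.mem_univ, if_true]

/-- Expansion of a bilinear form on an integer combination: `B(Σ aᵢvᵢ, Σ aⱼvⱼ) = Σᵢⱼ B(vᵢ,vⱼ) aᵢ aⱼ`. [folklore] -/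
theorem hth_bilin_expand {V : Type*} [AddCommGroup V] [Module ℝ V] (B : V →ₗ[ℝ] V →ₗ[ℝ] ℝ) {n : ℕ}
    (v : Fin n → V) (a : Fin n → ℝ) :
    B (∑ i : Fin n, a i • v i) (∑ j : Fin n, a j • v j) = ∑ i : Fin n, ∑ j : Fin n, B (v i) (v j) * a i * a j := by
  rw [map_sum B (fun i => a i • v i) Finset.univ, LinearMap.sum_apply]
  refine Finset.sum_congr rfl fun i _ => ?_
  rw [map_smul, LinearMap.smul_apply, map_sum (B (v i)) (fun j => a j • v j) Finset.univ, smul_eq_mul,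
    Finset.mul_sum]
  refine Finset.sum_congr rfl fun j _ => ?_
  rw [map_smul, smul_eq_mul]
  ring

/-- **The strain of a holonomy sector is the integer combination of the three unit strains**:
`σ(seam h) = Σ_i h_i • σ(seam e_i)` for any additive strain map (`stub_strainAdditive`). [folklore] -/
theorem hth_strain_seam_eq_sum (c : Table r) {c₀ : ℝ} (hr : 2 ≤ r) (hc₀ : 0 < c₀)
    (hA : c.sum (fun _ a => a) = 0)
    (hC : ∀ φ : W r → ℝ, c₀ * ∑ w, ∑ w', (1 - Real.cos (φ w - φ w')) ≤ (genF c φ).re)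
    (P : (Λ L M → Fin 3 → ℝ) → Λ L M → W r → ℝ)
    (hP : ∀ (ω : Λ L M → Fin 3 → ℝ) (s : Λ L M) (w : W r), P ω s w =
      (TorusChart.piProdZMod 2 L M).lineSum ω 0 (w.1 : ℕ) s
        + (TorusChart.piProdZMod 2 L M).lineSum ω 1 (w.2.1 : ℕ) (s + (w.1 : ℕ) • (TorusChart.piProdZMod 2 L M).gen 0)
        + (TorusChart.piProdZMod 2 L M).lineSum ω 2 (w.2.2 : ℕ)
          (s + (w.1 : ℕ) • (TorusChart.piProdZMod 2 L M).gen 0 + (w.2.1 : ℕ) • (TorusChart.piProdZMod 2 L M).gen 1))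
    (Q : (W r → ℝ) → ℝ) (hQ : ∀ u : W r → ℝ, Q u = (-c.sum (fun n a => a * (((∑ w, (n w : ℝ) * u w) ^ 2 : ℝ) : ℂ))).re)
    (σ : {a : Λ L M → Fin 3 → ℤ // ∀ (y : Λ L M) (μ : Fin 3),
      (∀ ν : Fin 3, μ < ν → (TorusChart.piProdZMod 2 L M).cval ν y = 0) →
      (TorusChart.piProdZMod 2 L M).cval μ y + 1 < (TorusChart.piProdZMod 2 L M).period μ → a y μ = 0} →
      (Λ L M → Fin 3 → ℝ))
    (hcls : ∀ a, ∃ ψ : Λ L M → ℝ, σ a = fun x i => 2 * Real.pi * (a.1 x i : ℝ) - (TorusChart.piProdZMod 2 L M).d₀ ψ x i)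
    (hpy : ∀ a (u : Λ L M → ℝ), ∑ s : Λ L M, Q (P (fun x i => (TorusChart.piProdZMod 2 L M).d₀ u x i - σ a x i) s)
      = ∑ s : Λ L M, Q (P ((TorusChart.piProdZMod 2 L M).d₀ u) s) + ∑ s : Λ L M, Q (P (σ a) s))
    (h : Fin 3 → ℤ) :
    σ ⟨(TorusChart.piProdZMod 2 L M).seam h, hth_seam_comb h⟩
      = ∑ i : Fin 3, (h i : ℝ) • σ ⟨(TorusChart.piProdZMod 2 L M).seam (Pi.single i (1 : ℤ)),
          hth_seam_comb (Pi.single i (1 : ℤ))⟩ := by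
  obtain ⟨hadd, _, _⟩ := stub_strainAdditive r c c₀ hr hc₀ hA hC L M P hP Q hQ σ hcls hpy
  -- the strain of a seam, as an additive map of the flux vector
  let f : (Fin 3 → ℤ) → (Λ L M → Fin 3 → ℝ) := fun k => σ ⟨(TorusChart.piProdZMod 2 L M).seam k, hth_seam_comb k⟩
  have hf : ∀ k, f k = σ ⟨(TorusChart.piProdZMod 2 L M).seam k, hth_seam_comb k⟩ := fun _ => rfl
  have hfadd : ∀ k k', f (k + k') = f k + f k' := by
    intro k k'
    rw [hf, hf, hf, ← hadd]
    congr 1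
    apply Subtype.ext
    exact (TorusChart.piProdZMod 2 L M).seam_add k k'
  let fh : (Fin 3 → ℤ) →+ (Λ L M → Fin 3 → ℝ) := AddMonoidHom.mk' f hfadd
  have hfh : ∀ k, fh k = f k := fun _ => rfl
  show f h = ∑ i : Fin 3, (h i : ℝ) • f (Pi.single i (1 : ℤ))
  conv_lhs => rw [hth_eq_sum_single h]
  rw [← hfh, map_sum]
  refine Finset.sum_congr rfl fun i _ => ?_
  rw [map_zsmul, hfh, ← Int.cast_smul_eq_zsmul ℝ]

/-- **Registered stub `stub_holonomyQuadraticForm` (prover seat 1 on stmt-HubbardSuperconductivity-14845; chapter 2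
§2.1): the holonomy sectors form a tilted three-dimensional theta series.**  For a table with `Σ c_n = 0` and
coercivity (C) at range `r ≥ 2` and ANY strain map `σ` with the two properties of `FSUnfolding.stub_fsRepresentation`,
there is a symmetric real `3 × 3` matrix `S` with, for every flux vector `h ∈ ℤ³`:
(1) `𝒬(σ(seam h)) = Σ_{ij} S_{ij} h_i h_j`; (2) `8π²c₀|Λ|(h₀²/L² + h₁²/L² + h₂²/M²) ≤ Σ_{ij} S_{ij} h_i h_j`
(`stub_windingSectorCostLower`); (3) `Σ_{ij} S_{ij} h_i h_j ≤ |Λ|·Q(w ↦ 2π(h₀w₁/L + h₁w₂/L + h₂w₃/M))` (B5); and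
(4) every real-linear functional of the strain is linear in the flux: `ℓ(σ(seam h)) = Σ_i h_i ℓ(σ(seam e_i))` (so the
Berry phase of stub D1 is `exp(iK τ·h)` on the holonomy sectors).  `S_{ij} = B(σ(seam e_i), σ(seam e_j))` is the
stiffness (helicity) matrix of the torus. [folklore] -/
theorem stub_holonomyQuadraticForm : ∀ (r : ℕ) (c : Table r) (c₀ : ℝ), 2 ≤ r → 0 < c₀ → c.sum (fun _ a => a) = 0 → (∀ φ : W r → ℝ, c₀ * ∑ w, ∑ w', (1 - Real.cos (φ w - φ w')) ≤ (genF c φ).re) → ∀ (L M : ℕ) [NeZero L] [NeZero M] (P : (Λ L M → Fin 3 → ℝ) → Λ L M → W r → ℝ), (∀ (ω : Λ L M → Fin 3 → ℝ) (s : Λ L M) (w : W r), P ω s w = (Literature.MathematicalPhysics.QuantumFieldTheory.TorusChart.piProdZMod 2 L M).lineSum ω 0 (w.1 : ℕ) s + (Literature.MathematicalPhysics.QuantumFieldTheory.TorusChart.piProdZMod 2 L M).lineSum ω 1 (w.2.1 : ℕ) (s + (w.1 : ℕ) • (Literature.MathematicalPhysics.QuantumFieldTheory.TorusChart.piProdZMod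 2 L M).gen 0) + (Literature.MathematicalPhysics.QuantumFieldTheory.TorusChart.piProdZMod 2 L M).lineSum ω 2 (w.2.2 : ℕ) (s + (w.1 : ℕ) • (Literature.MathematicalPhysics.QuantumFieldTheory.TorusChart.piProdZMod 2 L M).gen 0 + (w.2.1 : ℕ) • (Literature.MathematicalPhysics.QuantumFieldTheory.TorusChart.piProdZMod 2 L M).gen 1)) → ∀ (Q : (W r → ℝ) → ℝ), (∀ u : W r → ℝ, Q u = (-c.sum (fun n a => a * (((∑ w, (n w : ℝ) * u w) ^ 2 : ℝ) : ℂ))).re) → ∀ (σ : {a : Λ L M → Fin 3 → ℤ // ∀ (y : Λ L M) (μ : Fin 3), (∀ ν : Fin 3, μ < ν → (Literature.MathematicalPhysics.QuantumFieldTheory.TorusChart.piProdZMod 2 L M).cval ν y = 0) → (Literature.MathematicalPhysics.QuantumFieldTheory.TorusChart.piProdZMod 2 L M).cval μ y + 1 < (Literature.MathematicalPhysics.QuantumFieldTheory.TorusChart.piProdZMod 2 L M).period μ → a y μ = 0} → (Λ L M → Fin 3 → ℝ)), (∀ a, ∃ ψ : Λ L M → ℝ, σ a = fun x i => 2 * Real.pi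 * (a.1 x i : ℝ) - (Literature.MathematicalPhysics.QuantumFieldTheory.TorusChart.piProdZMod 2 L M).d₀ ψ x i) → (∀ a (u : Λ L M → ℝ), ∑ s : Λ L M, Q (P (fun x i => (Literature.MathematicalPhysics.QuantumFieldTheory.TorusChart.piProdZMod 2 L M).d₀ u x i - σ a x i) s) = ∑ s : Λ L M, Q (P ((Literature.MathematicalPhysics.QuantumFieldTheory.TorusChart.piProdZMod 2 L M).d₀ u) s) + ∑ s : Λ L M, Q (P (σ a) s)) → ∃ S : Fin 3 → Fin 3 → ℝ, (∀ i j, S i j = S j i) ∧ (∀ h : Fin 3 → ℤ, ∑ s : Λ L M, Q (P (σ ⟨(Literature.MathematicalPhysics.QuantumFieldTheory.TorusChart.piProdZMod 2 L M).seam h, fun y μ _ hμ => (Literature.MathematicalPhysics.QuantumFieldTheory.TorusChart.piProdZMod 2 L M).seam_of_lt h y μ hμ⟩) s) = ∑ i : Fin 3, ∑ j : Fin 3, S i j * (h i : ℝ) * (h j : ℝ)) ∧ (∀ h : Fin 3 → ℤ, 8 * Real.pi ^ 2 * c₀ * (Fintype.card (Λ L M) : ℝ) * (((h 0 : ℤ)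 : ℝ) ^ 2 / (L : ℝ) ^ 2 + ((h 1 : ℤ) : ℝ) ^ 2 / (L : ℝ) ^ 2 + ((h 2 : ℤ) : ℝ) ^ 2 / (M : ℝ) ^ 2) ≤ ∑ i : Fin 3, ∑ j : Fin 3, S i j * (h i : ℝ) * (h j : ℝ)) ∧ (∀ h : Fin 3 → ℤ, ∑ i : Fin 3, ∑ j : Fin 3, S i j * (h i : ℝ) * (h j : ℝ) ≤ (Fintype.card (Λ L M) : ℝ) * Q (fun w : W r => 2 * Real.pi * ((h 0 : ℝ) * ((w.1 : ℕ) : ℝ) / L + (h 1 : ℝ) * ((w.2.1 : ℕ) : ℝ) / L + (h 2 : ℝ) * ((w.2.2 : ℕ) : ℝ) / M))) ∧ (∀ (ℓ : (Λ L M → Fin 3 → ℝ) →ₗ[ℝ] ℝ) (h : Fin 3 → ℤ), ℓ (σ ⟨(Literature.MathematicalPhysics.QuantumFieldTheory.TorusChart.piProdZMod 2 L M).seam h, fun y μ _ hμ => (Literature.MathematicalPhysics.QuantumFieldTheory.TorusChart.piProdZMod 2 L M).seam_of_lt h y μ hμ⟩) = ∑ i : Fin 3, (h i : ℝ) * ℓ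 (σ ⟨(Literature.MathematicalPhysics.QuantumFieldTheory.TorusChart.piProdZMod 2 L M).seam (Pi.single i (1 : ℤ)), fun y μ _ hμ => (Literature.MathematicalPhysics.QuantumFieldTheory.TorusChart.piProdZMod 2 L M).seam_of_lt (Pi.single i (1 : ℤ)) y μ hμ⟩)) := by
  intro r c c₀ hr hc₀ hA hC L M _ _ P hP Q hQ σ hcls hpy
  obtain ⟨B, hBsymm, hBdiag⟩ := FSUnfolding.stub_thinFormPolar r c L M P hP Q hQ
  -- the three unit strains; `S_{ij} = B(v_i, v_j)`
  have hsum : ∀ h : Fin 3 → ℤ, σ ⟨(TorusChart.piProdZMod 2 L M).seam h, hth_seam_comb h⟩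
      = ∑ i : Fin 3, (h i : ℝ) • σ ⟨(TorusChart.piProdZMod 2 L M).seam (Pi.single i (1 : ℤ)),
          hth_seam_comb (Pi.single i (1 : ℤ))⟩ :=
    fun h => hth_strain_seam_eq_sum c hr hc₀ hA hC P hP Q hQ σ hcls hpy h
  have hquad : ∀ h : Fin 3 → ℤ, ∑ s : Λ L M, Q (P (σ ⟨(TorusChart.piProdZMod 2 L M).seam h, hth_seam_comb h⟩) s)
      = ∑ i : Fin 3, ∑ j : Fin 3,
          B (σ ⟨(TorusChart.piProdZMod 2 L M).seam (Pi.single i (1 : ℤ)), hth_seam_comb (Pi.single i (1 : ℤ))⟩)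
            (σ ⟨(TorusChart.piProdZMod 2 L M).seam (Pi.single j (1 : ℤ)), hth_seam_comb (Pi.single j (1 : ℤ))⟩)
          * (h i : ℝ) * (h j : ℝ) := by
    intro h
    rw [← hBdiag, hsum h]
    exact hth_bilin_expand B _ _
  refine ⟨fun i j => B (σ ⟨(TorusChart.piProdZMod 2 L M).seam (Pi.single i (1 : ℤ)), hth_seam_comb (Pi.single i (1 : ℤ))⟩)
      (σ ⟨(TorusChart.piProdZMod 2 L M).seam (Pi.single j (1 : ℤ)), hth_seam_comb (Pi.single j (1 : ℤ))⟩),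
    fun i j => hBsymm _ _, fun h => hquad h, fun h => ?_, fun h => ?_, fun ℓ h => ?_⟩
  · -- (2) lower bound (flux energy)
    rw [← hquad h]
    exact stub_windingSectorCostLower r c c₀ hr hc₀ hA hC L M P hP Q hQ h ((TorusChart.piProdZMod 2 L M).seam h)
      ((TorusChart.piProdZMod 2 L M).d₁_seam h) ((TorusChart.piProdZMod 2 L M).wind_seam h) _ (hcls _)
  · -- (3) upper bound (constant twist, B5)
    rw [← hquad h]
    exact FSUnfolding.stub_windingSectorCost r c c₀ hr hc₀ hA hC L M P hP Q hQ h ((TorusChart.piProdZMod 2 L M).seam h)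
      ((TorusChart.piProdZMod 2 L M).d₁_seam h) ((TorusChart.piProdZMod 2 L M).wind_seam h) _ (hcls _) (hpy _)
  · -- (4) linear functionals
    have hmem : (⟨(TorusChart.piProdZMod 2 L M).seam h, fun y μ _ hμ => (TorusChart.piProdZMod 2 L M).seam_of_lt h y μ hμ⟩ :
        {a : Λ L M → Fin 3 → ℤ // ∀ (y : Λ L M) (μ : Fin 3),
          (∀ ν : Fin 3, μ < ν → (TorusChart.piProdZMod 2 L M).cval ν y = 0) →
          (TorusChart.piProdZMod 2 L M).cval μ y + 1 < (TorusChart.piProdZMod 2 L M).period μ → a y μ = 0})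
        = ⟨(TorusChart.piProdZMod 2 L M).seam h, hth_seam_comb h⟩ := rfl
    rw [hmem, hsum h, map_sum]
    refine Finset.sum_congr rfl fun i _ => ?_
    rw [map_smul, smul_eq_mul]

end HolonomyTheta

end Summit.HubbardSuperconductivity.HubbardSuperconductivity.Theorems

end
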